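import Literature.Probability.Percolation.ZdFourArmSeparated
import Literature.Probability.Percolation.ZdFourArmSepGlue
import Literature.Probability.Percolation.ZdFiveArmPointBoundOfSeparation
import HarnessLib

/-!
# Gluing two well-separated four-arm events across an annulus (bond percolation on `ℤ²`):
# the probability estimate

Topic `Literature/Probability/Percolation`; bond percolation on `ℤ²` at `p = 1/2`. PROOFS ONLY (no
definition, no named fact). Probabilistic half of the gluing step of the quasi-multiplicativity of
the four-arm probability (`DuminilCopinManolescuTassion2021_zdFourArm_quasiMult`,
`ZdFourArmQuasiMult.lean`; DMT 2021, Prop. 6.3, "the proof follows the same lines as for `q = 2`":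
Kesten 1987, Lemma 6 with (2.43); Nolin 2008, Prop. 12 (ii) with Lemma 13 and Prop. 17), companion of
the deterministic step `mem_fourArmTwoClusters_of_glue` (`ZdFourArmSepGlue.lean`):

* `mem_fourArmTwoClusters_of_glue_face` — the deterministic step with the dual corridors in the
  face-walk form `dualFaceCrossing` of `ZdFiveArmPointBoundOfSeparation.lean` (the form whose
  locality `determinedBy_dualFaceCrossing` is in the tree), and `mem_fourArmTwoClusters_of_mem_glued`,
  its statement for the EVENTS `zdFourArmSep n ρ`, `zdFourArmSep ρ' R` and the eight corridor events;
* `le_real_lrCrossingAt_of_rsw_ratio`, `le_real_dualFaceCrossing_of_rsw_ratio` — RSW for corridors of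
  aspect ratio at most `k`; `gl_notMem_zoneRL`, `gl_notMem_zoneTB`, `gl_zone_box`,
  `gl_zone_small_box`, `gl_zone_big_notMem` — the corridor pairs avoid the foreign zones, the zones of
  the two annuli sit in disjoint boxes;
* `real_glued_ge` — **the gluing inequality**: with the generalised FKG inequality
  (`bondPercolation_locallyMonotone_fkg`, Nolin's Lemma 13: increasing class = the fenced open arms of
  both annuli and the four open corridors, decreasing class = the fenced dual arms and the four dual
  corridors, private pair sets = the corridor rectangles, common pairs = the remaining zone pairs),
  independence of the two well-separated events (disjoint zones, `bondPercolation_real_inter_of_disjoint`),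
  RSW at one fixed aspect ratio `k` (`rsw_lowerBound_holds`) and Harris in each class:
  `c⁸ · P(zdFourArmSep n ρ) · P(zdFourArmSep ρ' R) ≤ P(glued event)`;
* `real_fourArmTwoClusters_ge_of_sep` — hence `c⁸ · P(zdFourArmSep n ρ) · P(zdFourArmSep ρ' R) ≤
  P(fourArmTwoClusters r R)` for `2 ≤ r`, `r + n/8 + 1 ≤ n`, `128 ≤ n`, `2n ≤ ρ`, `2ρ ≤ ρ'`,
  `ρ + ρ/8 + 1 ≤ ρ'/2`, `2ρ' ≤ R` (the input of `zdFourArm_quasiMult_of_spaced`,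
  `ZdFourArmQuasiMultProofs.lean`, once arm separation supplies `P(zdFourArmSep) ≥ c P(fourArmTwoClusters)`).

## References

* H. Kesten, *Scaling relations for 2D-percolation*, Comm. Math. Phys. 109 (1987), §2, Lemma 6,
  (2.43) [KestenScalingCMP1987].
* P. Nolin, *Near-critical percolation in two dimensions*, EJP 13 (2008), §4.3 Prop. 12, Lemma 13,
  §4.5 Prop. 17 (arXiv 0711.4948: Prop. 11, Lemma 12, Prop. 16) [Nolin2008].
* H. Duminil-Copin, I. Manolescu, V. Tassion, PTRF 181 (2021), §6.2 Prop. 6.3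
  [DuminilCopinManolescuTassion2021].

Tree: `ZdFourArmSepGlue.lean` (deterministic step and its lemmas), `ZdFourArmSeparated.lean`
(`zdFourArmSep`, `zdSepOpenArmR`, `determinedBy_zdSepOpenArmR`), `ZdFiveArmSeparated(Gluing).lean`
(events, zones, locality), `ZdFiveArmPointBoundOfSeparation.lean` (`dualFaceCrossing`,
`dualFaceCrossingPairs`, `le_real_inter_of_upper/lower`, `apply_le_of_mem_rectanglePairs`,
`apply_le_of_mem_dualFaceCrossingPairs`, `zone_sites`), `BondLocallyMonotoneFKG.lean`,
`FiniteEnergy.lean` (`bondPercolation_real_inter_of_disjoint`), `CrossingChains.lean`,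
`HarrisTheorem.lean` (`determinedBy_openCrossing_image`), `RSWLemma.lean` (`rsw_lowerBound_holds`).
-/

noncomputable section

open MeasureTheory Set

namespace Literature.Probability.Percolation

open LatticeModels SimpleGraph

/-! ### The deterministic step with face-walk dual corridors -/

section Face

variable {ω : BondConfig (Site 2)}

set_option maxHeartbeats 4000000 in
/-- **Deterministic gluing, face-walk form of the dual corridors** (same statement and proof as
`mem_fourArmTwoClusters_of_glue`, with `dualTBCrossingAt` replaced by the larger events
`dualFaceCrossing`, which is all the proof uses). [cite: KestenScalingCMP1987, §2 Lemma 6 and (2.43)] [cite: Nolin2008, §4.3 Prop. 12 (ii), proof (arXiv 0711.4948: Prop. 11)] -/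
theorem mem_fourArmTwoClusters_of_glue_face (hω : ω ⊆ (zdGraph 2).edgeSet)
    {r n ρ ρ' R M₀ K₀ M₁ K₁ h₀ h₁ : ℕ}
    (hr : 2 ≤ r) (hM₀ : r + M₀ + 1 = n) (hK₀ : r + K₀ + 2 = n) (hM₁ : ρ + M₁ + 2 = ρ') (hK₁ : ρ + K₁ + 4 = ρ')
    (hh₀r : h₀ + 1 ≤ r) (hh₀n : h₀ ≤ n / 64) (hh₁r : h₁ + 2 ≤ r) (hh₁n : h₁ ≤ n / 64)
    (hn8 : 1 ≤ n / 8) (hrn : r + n / 8 + 1 ≤ n) (hnρ : n ≤ ρ) (hρ8 : 1 ≤ ρ / 8)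
    (hρρ' : ρ + ρ / 8 + 1 ≤ ρ' - ρ' / 8) (hρ'8 : 1 ≤ ρ' / 8) (hρ'R : ρ' + ρ' / 8 ≤ R)
    (A₁ : ZdSepOpenArmR ω n ρ 0 (0 + (n / 64 : ℕ)) 0 (0 + (ρ / 64 : ℕ)))
    (B₁ : ZdSepOpenArmL ω n ρ 0 (0 + (n / 64 : ℕ)) 0 (0 + (ρ / 64 : ℕ)))
    (D₁ : ZdSepDualArmT ω n ρ 0 (0 + (n / 64 : ℕ)) 0 (0 + (ρ / 64 : ℕ)))
    (E₁ : ZdSepDualArmB ω n ρ 0 (0 + (n / 64 : ℕ)) 0 (0 + (ρ / 64 : ℕ)))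
    (A₂ : ZdSepOpenArmR ω ρ' R 0 (0 + (ρ' / 64 : ℕ)) 0 (0 + (R / 64 : ℕ)))
    (B₂ : ZdSepOpenArmL ω ρ' R 0 (0 + (ρ' / 64 : ℕ)) 0 (0 + (R / 64 : ℕ)))
    (D₂ : ZdSepDualArmT ω ρ' R 0 (0 + (ρ' / 64 : ℕ)) 0 (0 + (R / 64 : ℕ)))
    (E₂ : ZdSepDualArmB ω ρ' R 0 (0 + (ρ' / 64 : ℕ)) 0 (0 + (R / 64 : ℕ)))
    (hT₀R : ω ∈ lrCrossingAt ![(r : ℤ), 0] M₀ h₀)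
    (hT₀L : ω ∈ lrCrossingAt ![-((r : ℤ) + M₀), 0] M₀ h₀)
    (hT₁R : ω ∈ lrCrossingAt ![(ρ : ℤ) + 1, 0] M₁ (ρ / 64))
    (hT₁L : ω ∈ lrCrossingAt ![-((ρ : ℤ) + M₁ + 1), 0] M₁ (ρ / 64))
    (hD₀T : ω ∈ dualFaceCrossing ![0, (r : ℤ)] (h₁ + 1) K₀)
    (hD₀B : ω ∈ dualFaceCrossing ![0, -((r : ℤ) + K₀)] (h₁ + 1) K₀)
    (hD₁T : ω ∈ dualFaceCrossing ![0, (ρ : ℤ) + 2] (ρ / 64 + 1) K₁)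
    (hD₁B : ω ∈ dualFaceCrossing ![0, -((ρ : ℤ) + K₁ + 2)] (ρ / 64 + 1) K₁) :
    ω ∈ fourArmTwoClusters r R := by
  have hr1 : 1 ≤ r := by omega
  have hdiv₁ : ((ρ / 64 : ℕ) : ℤ) ≤ (ρ' / 64 : ℕ) := by exact_mod_cast Nat.div_le_div_right (by omega)
  have hρR : ρ + ρ / 8 ≤ R := by omega
  have hrρ' : r + ρ' / 8 ≤ ρ' := by omega
  have hdivR : ((R / 64 : ℕ) : ℤ) ≤ R := by exact_mod_cast Nat.div_le_self R 64
  have hR1 : 1 ≤ R := by omega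
  ------------------------------------------------------------------
  -- RIGHT open crossing
  ------------------------------------------------------------------
  obtain ⟨e, y₀, T₀, he0, hy₀, hT₀s, hT₀o⟩ := exists_walk_of_mem_lrCrossingAt hω hT₀R
  simp only [Matrix.cons_val_zero, Matrix.cons_val_one] at he0 hy₀ hT₀s
  obtain ⟨m₀, hm₀, U₀, hU₀s, hU₀o⟩ := A₁.exists_walk_of_innerCorridor hn8 T₀ (by omega) (by omega)
    (fun z hz => ⟨by have := hT₀s z hz; omega, fun _ => by have := hT₀s z hz; omega⟩)
  obtain ⟨x₁, y₁, T₁, hx₁, hy₁, hT₁s, hT₁o⟩ := exists_walk_of_mem_lrCrossingAt hω hT₁R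
  simp only [Matrix.cons_val_zero, Matrix.cons_val_one] at hx₁ hy₁ hT₁s
  obtain ⟨m₁, hm₁, U₁, hU₁s, hU₁o⟩ := A₁.exists_walk_of_outerCorridor hρ8 T₁ (by omega) (by omega)
    (fun z hz => ⟨by have := hT₁s z hz; omega, fun _ => by have := hT₁s z hz; omega⟩)
  obtain ⟨m₂, hm₂, U₂, hU₂s, hU₂o⟩ := A₂.exists_walk_of_innerCorridor_sharp hρ'8 T₁ (by omega) (by omega)
    (fun z hz => ⟨by have := hT₁s z hz; omega, fun _ => by have := hT₁s z hz; omega⟩)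
  obtain ⟨S₀, hS₀s, hS₀e⟩ := exists_walk_within_support T₀ T₀.start_mem_support hm₀
  obtain ⟨S₁, hS₁s, hS₁e⟩ := exists_walk_within_support T₁ hm₁ hm₂
  have okT₀ : ∀ z ∈ T₀.support, z ∈ sqAnnulus r R := fun z hz =>
    mem_sqAnnulus_of_corridorR hr1 (by omega) (by omega) (by omega) (hT₀s z hz)
  have okT₁ : ∀ z ∈ T₁.support, z ∈ sqAnnulus r R := fun z hz =>
    mem_sqAnnulus_of_corridorR hr1 (by omega) (by omega) (by omega) (hT₁s z hz)
  have okA₁ := A₁.carrier_subset_sqAnnulus hr1 (by omega) hnρ hρR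
  have hPR := openWalk_append S₀ (U₀.reverse.append (U₁.append (S₁.append (U₂.reverse.append A₂.W))))
    ⟨fun z hz => okT₀ z (hS₀s z hz), fun e he => hT₀o e (hS₀e e he)⟩
    (openWalk_append _ _ (openWalk_reverse U₀ ⟨fun z hz => okA₁ z (hU₀s z hz), hU₀o⟩)
      (openWalk_append _ _ ⟨fun z hz => okA₁ z (hU₁s z hz), hU₁o⟩
        (openWalk_append _ _ ⟨fun z hz => okT₁ z (hS₁s z hz), fun e he => hT₁o e (hS₁e e he)⟩
          (openWalk_append _ _
            (openWalk_reverse U₂ ⟨fun z hz => A₂.inner_subset_sqAnnulus hr1 hrρ' hρ'R (hU₂s z hz), hU₂o⟩)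
            ⟨fun z hz => sqAnnulus_mono (by omega) le_rfl (A₂.hW z hz), A₂.hWo⟩))))
  have connR : ω ∈ openConnIn (sqAnnulus r R) e A₂.z := mem_openConnIn_of_walk _ hPR.1 hPR.2
  ------------------------------------------------------------------
  -- LEFT open crossing
  ------------------------------------------------------------------
  obtain ⟨xL, w, T₀L, hxL, hw, hT₀Ls, hT₀Lo⟩ := exists_walk_of_mem_lrCrossingAt hω hT₀L
  simp only [Matrix.cons_val_zero, Matrix.cons_val_one] at hxL hw hT₀Ls
  obtain ⟨m₀L, hm₀L, U₀L, hU₀Ls, hU₀Lo⟩ := B₁.exists_walk_of_innerCorridor hn8 T₀L.reverse (by omega) (by omega)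
    (fun z hz => by
      rw [Walk.support_reverse, List.mem_reverse] at hz
      exact ⟨by have := hT₀Ls z hz; omega, fun _ => by have := hT₀Ls z hz; omega⟩)
  obtain ⟨x₁L, y₁L, T₁L, hx₁L, hy₁L, hT₁Ls, hT₁Lo⟩ := exists_walk_of_mem_lrCrossingAt hω hT₁L
  simp only [Matrix.cons_val_zero, Matrix.cons_val_one] at hx₁L hy₁L hT₁Ls
  obtain ⟨m₁L, hm₁L, U₁L, hU₁Ls, hU₁Lo⟩ := B₁.exists_walk_of_outerCorridor hρ8 T₁L.reverse (by omega) (by omega)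
    (fun z hz => by
      rw [Walk.support_reverse, List.mem_reverse] at hz
      exact ⟨by have := hT₁Ls z hz; omega, fun _ => by have := hT₁Ls z hz; omega⟩)
  obtain ⟨m₂L, hm₂L, U₂L, hU₂Ls, hU₂Lo⟩ := B₂.exists_walk_of_innerCorridor_sharp hρ'8 T₁L.reverse (by omega) (by omega)
    (fun z hz => by
      rw [Walk.support_reverse, List.mem_reverse] at hz
      exact ⟨by have := hT₁Ls z hz; omega, fun _ => by have := hT₁Ls z hz; omega⟩)
  obtain ⟨S₀L, hS₀Ls, hS₀Le⟩ := exists_walk_within_support T₀L.reverse T₀L.reverse.start_mem_support hm₀L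
  obtain ⟨S₁L, hS₁Ls, hS₁Le⟩ := exists_walk_within_support T₁L.reverse hm₁L hm₂L
  have okT₀L : ∀ z ∈ T₀L.reverse.support, z ∈ sqAnnulus r R := fun z hz => by
    rw [Walk.support_reverse, List.mem_reverse] at hz
    exact mem_sqAnnulus_of_corridorL hr1 (by omega) (by omega) (by omega) (hT₀Ls z hz)
  have okT₀Le : ∀ e ∈ T₀L.reverse.edges, e ∈ ω := fun e he => by
    rw [Walk.edges_reverse, List.mem_reverse] at he; exact hT₀Lo e he
  have okT₁L : ∀ z ∈ T₁L.reverse.support, z ∈ sqAnnulus r R := fun z hz => by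
    rw [Walk.support_reverse, List.mem_reverse] at hz
    exact mem_sqAnnulus_of_corridorL hr1 (by omega) (by omega) (by omega) (hT₁Ls z hz)
  have okT₁Le : ∀ e ∈ T₁L.reverse.edges, e ∈ ω := fun e he => by
    rw [Walk.edges_reverse, List.mem_reverse] at he; exact hT₁Lo e he
  have okB₁ := B₁.carrier_subset_sqAnnulus hr1 (by omega) hnρ hρR
  have hPL := openWalk_append S₀L (U₀L.reverse.append (U₁L.append (S₁L.append (U₂L.reverse.append B₂.W))))
    ⟨fun z hz => okT₀L z (hS₀Ls z hz), fun e he => okT₀Le e (hS₀Le e he)⟩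
    (openWalk_append _ _ (openWalk_reverse U₀L ⟨fun z hz => okB₁ z (hU₀Ls z hz), hU₀Lo⟩)
      (openWalk_append _ _ ⟨fun z hz => okB₁ z (hU₁Ls z hz), hU₁Lo⟩
        (openWalk_append _ _ ⟨fun z hz => okT₁L z (hS₁Ls z hz), fun e he => okT₁Le e (hS₁Le e he)⟩
          (openWalk_append _ _
            (openWalk_reverse U₂L ⟨fun z hz => B₂.inner_subset_sqAnnulus hr1 hrρ' hρ'R (hU₂Ls z hz), hU₂Lo⟩)
            ⟨fun z hz => sqAnnulus_mono (by omega) le_rfl (B₂.hW z hz), B₂.hWo⟩))))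
  have connL : ω ∈ openConnIn (sqAnnulus r R) w B₂.z := mem_openConnIn_of_walk _ hPL.1 hPL.2
  ------------------------------------------------------------------
  -- TOP dual arm from the face `(c₁ 0, r - 1)` to the level `R`
  ------------------------------------------------------------------
  obtain ⟨aT, bT, W₀, haT, hbT, hW₀s, hW₀c⟩ := hD₀T
  simp only [Matrix.cons_val_zero, Matrix.cons_val_one] at haT hbT hW₀s
  obtain ⟨c₁, V₀, hc₁1, -, ⟨xT, hxT, hxT0, -⟩, hV₀s, hV₀c, hV₀off⟩ :=
    exists_faceWalk_exit_row_lt W₀ hW₀c r (by omega) (by omega)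
  have hc₁0 : 0 ≤ c₁ 0 ∧ c₁ 0 ≤ h₁ := by have := hW₀s xT hxT; omega
  obtain ⟨mT₀, hmT₀, Y₀, -, hY₀c, hY₀f⟩ := D₁.exists_faceWalk_of_innerCorridor hn8 V₀.reverse (by omega) (by omega)
    (fun z hz => by
      rw [Walk.support_reverse, List.mem_reverse] at hz
      have := hW₀s z (hV₀s z hz)
      exact ⟨by omega, fun _ => by omega⟩)
  obtain ⟨aM, bM, W₁, haM, hbM, hW₁s, hW₁c⟩ := hD₁T
  simp only [Matrix.cons_val_zero, Matrix.cons_val_one] at haM hbM hW₁s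
  obtain ⟨mT₁, hmT₁, Y₁, -, hY₁c, hY₁f⟩ := D₁.exists_faceWalk_of_outerCorridor hρ8 W₁.reverse (by omega) (by omega)
    (fun z hz => by
      rw [Walk.support_reverse, List.mem_reverse] at hz
      have := hW₁s z hz
      exact ⟨by omega, fun _ => by omega⟩)
  obtain ⟨mT₂, hmT₂, Y₂, -, hY₂c, hY₂f⟩ := D₂.exists_faceWalk_of_innerCorridor hρ'8 W₁.reverse (by omega) (by omega)
    (fun z hz => by
      rw [Walk.support_reverse, List.mem_reverse] at hz
      have := hW₁s z hz
      exact ⟨by omega, fun _ => by omega⟩)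
  obtain ⟨Z₀, -, hZ₀d⟩ := exists_faceWalk_within_support V₀.reverse V₀.reverse.start_mem_support hmT₀
  obtain ⟨Z₁, -, hZ₁d⟩ := exists_faceWalk_within_support W₁.reverse hmT₁ hmT₂
  have okV₀ : ∀ d ∈ V₀.reverse.darts, sepEdge d.fst d.snd ∉ ω ∧ ∀ v ∈ sepEdge d.fst d.snd, v ∉ box 2 (r - 1) :=
    faceWalk_reverse V₀ fun d hd => ⟨hV₀c d hd, fun v hv => notMem_box_of_lt_apply 1 (by have := hV₀off d hd v hv; omega)⟩
  have okY₀ := D₁.dartProp_of_fence hr1 hrn hnρ Y₀ hY₀c (fun d hd v hv => Or.inr (hY₀f d hd v hv))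
  have okY₁ := D₁.dartProp_of_fence hr1 hrn hnρ Y₁ hY₁c hY₁f
  have okW₁ := faceWalk_reverse W₁ (dartProp_of_rows_ge hr1 (lo := (ρ : ℤ) + 2 - 1) (by omega) W₁ hW₁c
    (fun z hz => (hW₁s z hz).2.2.1))
  have okY₂ := D₂.dartProp_of_fence hr1 (by omega) (by omega) Y₂ hY₂c (fun d hd v hv => Or.inr (hY₂f d hd v hv))
  have okQ₂ := dartProp_of_body (by omega : r ≤ ρ') hr1 D₂.Q D₂.hQc D₂.hQa
  have hδ₁ := faceWalk_append Z₀ (Y₀.reverse.append (Y₁.append (Z₁.append (Y₂.reverse.append D₂.Q))))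
    (faceWalk_of_within _ okV₀ Z₀ hZ₀d)
    (faceWalk_append _ _ (faceWalk_reverse Y₀ okY₀)
      (faceWalk_append _ _ okY₁
        (faceWalk_append _ _ (faceWalk_of_within _ okW₁ Z₁ hZ₁d)
          (faceWalk_append _ _ (faceWalk_reverse Y₂ okY₂) okQ₂))))
  have hgD₂ := D₂.hg
  ------------------------------------------------------------------
  -- BOTTOM dual arm from the face `(c₂ 0, -r)` to the level `-R-1`
  ------------------------------------------------------------------
  obtain ⟨aB, bB, X₀, haB, hbB, hX₀s, hX₀c⟩ := hD₀B
  simp only [Matrix.cons_val_zero, Matrix.cons_val_one] at haB hbB hX₀s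
  obtain ⟨c₂, V₀', hc₂1, -, ⟨xB, hxB, hxB0, -⟩, hV₀'s, hV₀'c, hV₀'off⟩ :=
    exists_faceWalk_exit_row_ge X₀.reverse (forall_darts_reverse_sepEdge_notMem X₀ hX₀c) r (by omega) (by omega)
  have hc₂0 : 0 ≤ c₂ 0 ∧ c₂ 0 ≤ h₁ := by
    rw [Walk.support_reverse, List.mem_reverse] at hxB
    have := hX₀s xB hxB; omega
  obtain ⟨mB₀, hmB₀, Y₀', -, hY₀'c, hY₀'f⟩ := E₁.exists_faceWalk_of_innerCorridor hn8 V₀'.reverse (by omega) (by omega)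
    (fun z hz => by
      rw [Walk.support_reverse, List.mem_reverse] at hz
      have hz' := hV₀'s z hz
      rw [Walk.support_reverse, List.mem_reverse] at hz'
      have := hX₀s z hz'
      exact ⟨by omega, fun _ => by omega⟩)
  obtain ⟨aN, bN, X₁, haN, hbN, hX₁s, hX₁c⟩ := hD₁B
  simp only [Matrix.cons_val_zero, Matrix.cons_val_one] at haN hbN hX₁s
  obtain ⟨mB₁, hmB₁, Y₁', -, hY₁'c, hY₁'f⟩ := E₁.exists_faceWalk_of_outerCorridor hρ8 X₁ (by omega) (by omega)
    (fun z hz => by have := hX₁s z hz; exact ⟨by omega, fun _ => by omega⟩)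
  obtain ⟨mB₂, hmB₂, Y₂', -, hY₂'c, hY₂'f⟩ := E₂.exists_faceWalk_of_innerCorridor hρ'8 X₁ (by omega) (by omega)
    (fun z hz => by have := hX₁s z hz; exact ⟨by omega, fun _ => by omega⟩)
  obtain ⟨Z₀', -, hZ₀'d⟩ := exists_faceWalk_within_support V₀'.reverse V₀'.reverse.start_mem_support hmB₀
  obtain ⟨Z₁', -, hZ₁'d⟩ := exists_faceWalk_within_support X₁ hmB₁ hmB₂
  have okV₀' : ∀ d ∈ V₀'.reverse.darts, sepEdge d.fst d.snd ∉ ω ∧ ∀ v ∈ sepEdge d.fst d.snd, v ∉ box 2 (r - 1) :=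
    faceWalk_reverse V₀' fun d hd =>
      ⟨hV₀'c d hd, fun v hv => notMem_box_of_apply_lt 1 (by have := hV₀'off d hd v hv; omega)⟩
  have okY₀' := E₁.dartProp_of_fence hr1 hrn hnρ Y₀' hY₀'c (fun d hd v hv => Or.inr (hY₀'f d hd v hv))
  have okY₁' := E₁.dartProp_of_fence hr1 hrn hnρ Y₁' hY₁'c hY₁'f
  have okX₁ := dartProp_of_rows_le hr1 (hi := -((ρ : ℤ) + K₁ + 2) + K₁) (by omega) X₁ hX₁c
    (fun z hz => (hX₁s z hz).2.2.2)
  have okY₂' := E₂.dartProp_of_fence hr1 (by omega) (by omega) Y₂' hY₂'c (fun d hd v hv => Or.inr (hY₂'f d hd v hv))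
  have okQ₂' := dartProp_of_body (by omega : r ≤ ρ') hr1 E₂.Q E₂.hQc E₂.hQa
  have hδ₂ := faceWalk_append Z₀' (Y₀'.reverse.append (Y₁'.append (Z₁'.append (Y₂'.reverse.append E₂.Q))))
    (faceWalk_of_within _ okV₀' Z₀' hZ₀'d)
    (faceWalk_append _ _ (faceWalk_reverse Y₀' okY₀')
      (faceWalk_append _ _ okY₁'
        (faceWalk_append _ _ (faceWalk_of_within _ okX₁ Z₁' hZ₁'d)
          (faceWalk_append _ _ (faceWalk_reverse Y₂' okY₂') okQ₂'))))
  have hgE₂ := E₂.hg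
  ------------------------------------------------------------------
  -- assembly
  ------------------------------------------------------------------
  have he1 : 0 ≤ e 1 ∧ e 1 ≤ h₀ := by have := hT₀s e T₀.start_mem_support; omega
  have hw1 : 0 ≤ w 1 ∧ w 1 ≤ h₀ := by have := hT₀Ls w T₀L.end_mem_support; omega
  have hw' : w 0 = -(r : ℤ) := by omega
  have hzA₂ := A₂.hz
  have hzB₂ := B₂.hz
  have hsep : ω ∉ openConnIn (sqAnnulus r R) e w :=
    not_openConnIn_sqAnnulus_of_dualArmsTB hr (by omega) hω he0 (abs_le.2 ⟨by omega, by omega⟩)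
      hw' (abs_le.2 ⟨by omega, by omega⟩)
      _ ⟨by omega, by omega, by omega⟩ (by omega) hδ₁ _ ⟨by omega, by omega, by omega⟩ (by omega) hδ₂
  exact ⟨e, mem_siteSphere_of_apply_zero hr1 (Or.inl he0) (abs_le.2 ⟨by omega, by omega⟩),
    w, mem_siteSphere_of_apply_zero hr1 (Or.inr hw') (abs_le.2 ⟨by omega, by omega⟩),
    A₂.z, mem_siteSphere_of_apply_zero hR1 (Or.inl hzA₂.1) (abs_le.2 ⟨by omega, by omega⟩),
    B₂.z, mem_siteSphere_of_apply_zero hR1 (Or.inr hzB₂.1) (abs_le.2 ⟨by omega, by omega⟩),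
    connR, connL, hsep⟩

end Face

/-- **The glued events give four arms** (`mem_fourArmTwoClusters_of_glue_face` for the events):
on a lattice configuration in `zdFourArmSep n ρ`, in `zdFourArmSep ρ' R` and in the eight corridor
events, `fourArmTwoClusters r R` occurs. [cite: Nolin2008, §4.3 Prop. 12 (ii), proof (arXiv 0711.4948: Prop. 11)] -/
theorem mem_fourArmTwoClusters_of_mem_glued {ω : BondConfig (Site 2)} (hω : ω ⊆ (zdGraph 2).edgeSet)
    {r n ρ ρ' R M₀ K₀ M₁ K₁ h₀ h₁ : ℕ}
    (hr : 2 ≤ r) (hM₀ : r + M₀ + 1 = n) (hK₀ : r + K₀ + 2 = n) (hM₁ : ρ + M₁ + 2 = ρ') (hK₁ : ρ + K₁ + 4 = ρ')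
    (hh₀r : h₀ + 1 ≤ r) (hh₀n : h₀ ≤ n / 64) (hh₁r : h₁ + 2 ≤ r) (hh₁n : h₁ ≤ n / 64)
    (hn8 : 1 ≤ n / 8) (hrn : r + n / 8 + 1 ≤ n) (hnρ : n ≤ ρ) (hρ8 : 1 ≤ ρ / 8)
    (hρρ' : ρ + ρ / 8 + 1 ≤ ρ' - ρ' / 8) (hρ'8 : 1 ≤ ρ' / 8) (hρ'R : ρ' + ρ' / 8 ≤ R)
    (hs₁ : ω ∈ zdFourArmSep n ρ) (hs₂ : ω ∈ zdFourArmSep ρ' R)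
    (hT₀R : ω ∈ lrCrossingAt ![(r : ℤ), 0] M₀ h₀)
    (hT₀L : ω ∈ lrCrossingAt ![-((r : ℤ) + M₀), 0] M₀ h₀)
    (hT₁R : ω ∈ lrCrossingAt ![(ρ : ℤ) + 1, 0] M₁ (ρ / 64))
    (hT₁L : ω ∈ lrCrossingAt ![-((ρ : ℤ) + M₁ + 1), 0] M₁ (ρ / 64))
    (hD₀T : ω ∈ dualFaceCrossing ![0, (r : ℤ)] (h₁ + 1) K₀)
    (hD₀B : ω ∈ dualFaceCrossing ![0, -((r : ℤ) + K₀)] (h₁ + 1) K₀)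
    (hD₁T : ω ∈ dualFaceCrossing ![0, (ρ : ℤ) + 2] (ρ / 64 + 1) K₁)
    (hD₁B : ω ∈ dualFaceCrossing ![0, -((ρ : ℤ) + K₁ + 2)] (ρ / 64 + 1) K₁) :
    ω ∈ fourArmTwoClusters r R := by
  obtain ⟨⟨⟨A₁⟩, ⟨B₁⟩⟩, ⟨⟨D₁⟩, ⟨E₁⟩⟩⟩ := hs₁
  obtain ⟨⟨⟨A₂⟩, ⟨B₂⟩⟩, ⟨⟨D₂⟩, ⟨E₂⟩⟩⟩ := hs₂
  have hA₁ : Nonempty (ZdSepOpenArmR ω n ρ 0 (0 + (n / 64 : ℕ)) 0 (0 + (ρ / 64 : ℕ))) := by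
    simpa only [zero_add] using (⟨A₁⟩ : Nonempty _)
  have hB₁ : Nonempty (ZdSepOpenArmL ω n ρ 0 (0 + (n / 64 : ℕ)) 0 (0 + (ρ / 64 : ℕ))) := by
    simpa only [zero_add] using (⟨B₁⟩ : Nonempty _)
  have hD₁ : Nonempty (ZdSepDualArmT ω n ρ 0 (0 + (n / 64 : ℕ)) 0 (0 + (ρ / 64 : ℕ))) := by
    simpa only [zero_add] using (⟨D₁⟩ : Nonempty _)
  have hE₁ : Nonempty (ZdSepDualArmB ω n ρ 0 (0 + (n / 64 : ℕ)) 0 (0 + (ρ / 64 : ℕ))) := by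
    simpa only [zero_add] using (⟨E₁⟩ : Nonempty _)
  have hA₂ : Nonempty (ZdSepOpenArmR ω ρ' R 0 (0 + (ρ' / 64 : ℕ)) 0 (0 + (R / 64 : ℕ))) := by
    simpa only [zero_add] using (⟨A₂⟩ : Nonempty _)
  have hB₂ : Nonempty (ZdSepOpenArmL ω ρ' R 0 (0 + (ρ' / 64 : ℕ)) 0 (0 + (R / 64 : ℕ))) := by
    simpa only [zero_add] using (⟨B₂⟩ : Nonempty _)
  have hD₂ : Nonempty (ZdSepDualArmT ω ρ' R 0 (0 + (ρ' / 64 : ℕ)) 0 (0 + (R / 64 : ℕ))) := by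
    simpa only [zero_add] using (⟨D₂⟩ : Nonempty _)
  have hE₂ : Nonempty (ZdSepDualArmB ω ρ' R 0 (0 + (ρ' / 64 : ℕ)) 0 (0 + (R / 64 : ℕ))) := by
    simpa only [zero_add] using (⟨E₂⟩ : Nonempty _)
  obtain ⟨A₁'⟩ := hA₁; obtain ⟨B₁'⟩ := hB₁; obtain ⟨D₁'⟩ := hD₁; obtain ⟨E₁'⟩ := hE₁
  obtain ⟨A₂'⟩ := hA₂; obtain ⟨B₂'⟩ := hB₂; obtain ⟨D₂'⟩ := hD₂; obtain ⟨E₂'⟩ := hE₂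
  exact mem_fourArmTwoClusters_of_glue_face hω hr hM₀ hK₀ hM₁ hK₁ hh₀r hh₀n hh₁r hh₁n hn8 hrn hnρ hρ8 hρρ' hρ'8
    hρ'R A₁' B₁' D₁' E₁' A₂' B₂' D₂' E₂' hT₀R hT₀L hT₁R hT₁L hD₀T hD₀B hD₁T hD₁B

/-! ### RSW at a fixed aspect ratio -/

/-- RSW lower bound for a corridor crossing of aspect ratio at most `k`. [cite: BollobasRiordan2006, Ch. 3, eq. (3)] -/
theorem le_real_lrCrossingAt_of_rsw_ratio {k : ℕ} {c : ℝ}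
    (hc : ∀ l : ℕ, 1 ≤ l → c ≤ crossingProb half (k * l - 1) (l - 1))
    (u : Site 2) {M n : ℕ} (hM : M ≤ k * (n + 1) - 1) :
    c ≤ (bondPercolation (zdGraph 2) half).real (lrCrossingAt u M n) := by
  rw [bondPercolation_real_lrCrossingAt]
  have h := hc (n + 1) (by omega)
  rw [Nat.add_sub_cancel] at h
  exact h.trans (crossingProb_anti_left half hM n)

/-- RSW lower bound for a dual corridor crossing of aspect ratio at most `k`. [cite: BollobasRiordan2006, Ch. 3, eq. (3) and Cor. 3(i)] -/
theorem le_real_dualFaceCrossing_of_rsw_ratio {k : ℕ} {c : ℝ}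
    (hc : ∀ l : ℕ, 1 ≤ l → c ≤ crossingProb half (k * l - 1) (l - 1))
    (u : Site 2) {m n' : ℕ} (hn : n' + 1 ≤ k * (m + 1) - 1) :
    c ≤ (bondPercolation (zdGraph 2) half).real (dualFaceCrossing u (m + 1) n') := by
  refine le_trans ?_ (crossingProb_le_real_dualFaceCrossing u m n')
  have h := hc (m + 1) (by omega)
  rw [Nat.add_sub_cancel] at h
  exact h.trans (crossingProb_anti_left half hn m)

/-! ### Geometry of the zones and of the corridor pairs -/

section Geometry

/-- Coordinates of a site of the square annulus. [folklore] -/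
theorem coords_of_mem_sqAnnulus {m N : ℕ} (hm : 1 ≤ m) {x : Site 2} (h : x ∈ sqAnnulus m N) :
    (-(N : ℤ) ≤ x 0 ∧ x 0 ≤ N) ∧ (-(N : ℤ) ≤ x 1 ∧ x 1 ≤ N) ∧
      ((m : ℤ) ≤ x 0 ∨ x 0 ≤ -(m : ℤ) ∨ (m : ℤ) ≤ x 1 ∨ x 1 ≤ -(m : ℤ)) := by
  rw [mem_sqAnnulus_iff hm, Fin.forall_fin_two, Fin.exists_fin_two] at h
  exact ⟨h.1.1, h.1.2, by tauto⟩

variable {r n ρ ρ' R h₀ h₁ : ℕ}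

/-- **(G1)** A site of a dual-corridor pair lies in no right/left zone of either annulus. [folklore] -/
theorem gl_notMem_zoneRL (hn : 128 ≤ n) (hrn : r + n / 8 + 1 ≤ n) (hh₁ : h₁ + 2 ≤ r)
    (hnρ : 2 * n ≤ ρ) (hρρ' : 2 * ρ ≤ ρ') (hρ'R : 2 * ρ' ≤ R) {x : Site 2}
    (hx : 0 ≤ x 0 ∧ (x 0 ≤ h₁ + 1 ∧ ((r : ℤ) - 1 ≤ x 1 ∧ x 1 ≤ n - 1 ∨ -(n : ℤ) + 1 ≤ x 1 ∧ x 1 ≤ -(r : ℤ) + 1) ∨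
      x 0 ≤ (ρ / 64 : ℕ) + 1 ∧ ((ρ : ℤ) + 1 ≤ x 1 ∧ x 1 ≤ ρ' - 1 ∨ -(ρ' : ℤ) + 1 ≤ x 1 ∧ x 1 ≤ -(ρ : ℤ) - 1))) :
    x ∉ zdSepZoneR n ρ ∪ zdSepZoneL n ρ ∪ (zdSepZoneR ρ' R ∪ zdSepZoneL ρ' R) := by
  have e1 : n / 4 + n / 64 + n / 64 + n / 8 + 1 ≤ n := by omega
  have e1' : ((n / 4 : ℕ) : ℤ) + (n / 64 : ℕ) + (n / 64 : ℕ) + (n / 8 : ℕ) + 1 ≤ n := by exact_mod_cast e1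
  have e2 : ρ / 64 + 2 + ρ / 8 ≤ ρ := by omega
  have e2' : ((ρ / 64 : ℕ) : ℤ) + 2 + (ρ / 8 : ℕ) ≤ ρ := by exact_mod_cast e2
  have e3 : ρ / 64 + 2 + ρ' / 8 ≤ ρ' := by omega
  have e3' : ((ρ / 64 : ℕ) : ℤ) + 2 + (ρ' / 8 : ℕ) ≤ ρ' := by exact_mod_cast e3
  rintro ((h | h) | (h | h))
  · rcases h with h | ⟨h0, h0', h1'⟩ | ⟨h0, h0', h1'⟩
    · have := coords_of_mem_sqAnnulus (by omega) h; omega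
    · omega
    · have := abs_le.1 h1'; omega
  · rcases h with h | ⟨h0, h0', h1'⟩ | ⟨h0, h0', h1'⟩
    · have := coords_of_mem_sqAnnulus (by omega) h; omega
    · omega
    · omega
  · rcases h with h | ⟨h0, h0', h1'⟩ | ⟨h0, h0', h1'⟩
    · have := coords_of_mem_sqAnnulus (by omega) h; omega
    · omega
    · omega
  · rcases h with h | ⟨h0, h0', h1'⟩ | ⟨h0, h0', h1'⟩
    · have := coords_of_mem_sqAnnulus (by omega) h; omega
    · omega
    · omega

/-- **(G2)** A site of an open-corridor pair lies in no top/bottom zone of either annulus. [folklore] -/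
theorem gl_notMem_zoneTB (hn : 128 ≤ n) (hrn : r + n / 8 + 1 ≤ n) (hh₀ : h₀ + 1 ≤ r)
    (hnρ : 2 * n ≤ ρ) (hρρ' : 2 * ρ ≤ ρ') (hρ'R : 2 * ρ' ≤ R) {x : Site 2}
    (hx : 0 ≤ x 1 ∧ (x 1 ≤ h₀ ∧ ((r : ℤ) ≤ x 0 ∧ x 0 ≤ n - 1 ∨ -(n : ℤ) + 1 ≤ x 0 ∧ x 0 ≤ -(r : ℤ)) ∨
      x 1 ≤ (ρ / 64 : ℕ) ∧ ((ρ : ℤ) + 1 ≤ x 0 ∧ x 0 ≤ ρ' - 1 ∨ -(ρ' : ℤ) + 1 ≤ x 0 ∧ x 0 ≤ -(ρ : ℤ) - 1))) :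
    x ∉ zdSepZoneT n ρ ∪ zdSepZoneB n ρ ∪ (zdSepZoneT ρ' R ∪ zdSepZoneB ρ' R) := by
  have e2 : ρ / 64 + ρ / 8 + 2 ≤ ρ := by omega
  have e2' : ((ρ / 64 : ℕ) : ℤ) + (ρ / 8 : ℕ) + 2 ≤ ρ := by exact_mod_cast e2
  have e3 : ρ / 64 + 2 + ρ' / 8 ≤ ρ' := by omega
  have e3' : ((ρ / 64 : ℕ) : ℤ) + 2 + (ρ' / 8 : ℕ) ≤ ρ' := by exact_mod_cast e3
  have e4 : n / 64 + n / 8 + 2 ≤ n := by omega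
  have e4' : ((n / 64 : ℕ) : ℤ) + (n / 8 : ℕ) + 2 ≤ n := by exact_mod_cast e4
  rintro ((h | h) | (h | h))
  · rcases h with h | ⟨h0, h0', h1, h1'⟩ | ⟨h0, h0', h1, h1'⟩
    · have := coords_of_mem_sqAnnulus (by omega) h; omega
    · omega
    · omega
  · rcases h with h | ⟨h0, h0', h1, h1'⟩ | ⟨h0, h0', h1, h1'⟩
    · have := coords_of_mem_sqAnnulus (by omega) h; omega
    · omega
    · omega
  · rcases h with h | ⟨h0, h0', h1, h1'⟩ | ⟨h0, h0', h1, h1'⟩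
    · have := coords_of_mem_sqAnnulus (by omega) h; omega
    · omega
    · omega
  · rcases h with h | ⟨h0, h0', h1, h1'⟩ | ⟨h0, h0', h1, h1'⟩
    · have := coords_of_mem_sqAnnulus (by omega) h; omega
    · omega
    · omega

/-- **All zones lie in the big box `B(R + R/8 + 1)`, off the hole `B(n/2)`.** [folklore] -/
theorem gl_zone_box (hn : 128 ≤ n) (hnρ : 2 * n ≤ ρ) (hρ' : 128 ≤ ρ') (hρρ' : ρ ≤ ρ') (hρ'R : 2 * ρ' ≤ R) {x : Site 2}
    (hx : x ∈ zdSepZoneR n ρ ∪ zdSepZoneL n ρ ∪ (zdSepZoneT n ρ ∪ zdSepZoneB n ρ) ∪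
      (zdSepZoneR ρ' R ∪ zdSepZoneL ρ' R ∪ (zdSepZoneT ρ' R ∪ zdSepZoneB ρ' R))) :
    x ∈ box 2 (R + R / 8 + 1) := by
  rw [mem_box, Fin.forall_fin_two]
  have hρR : ρ + ρ / 8 + 1 ≤ R + R / 8 + 1 := by omega
  have hρR' : (ρ : ℤ) + (ρ / 8 : ℕ) + 1 ≤ R + (R / 8 : ℕ) + 1 := by exact_mod_cast hρR
  rcases hx with hx | hx
  · obtain ⟨⟨h0, h1⟩, -⟩ := zone_sites hn hnρ hx
    have a0 := abs_le.1 h0; have a1 := abs_le.1 h1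
    push_cast
    exact ⟨⟨by omega, by omega⟩, ⟨by omega, by omega⟩⟩
  · obtain ⟨⟨h0, h1⟩, -⟩ := zone_sites hρ' hρ'R hx
    have a0 := abs_le.1 h0; have a1 := abs_le.1 h1
    push_cast
    exact ⟨⟨by omega, by omega⟩, ⟨by omega, by omega⟩⟩

/-- **The zones of the small annulus lie in `B(ρ + ρ/8 + 1)`.** [folklore] -/
theorem gl_zone_small_box (hn : 128 ≤ n) (hnρ : 2 * n ≤ ρ) {x : Site 2}
    (hx : x ∈ zdSepZoneR n ρ ∪ zdSepZoneL n ρ ∪ (zdSepZoneT n ρ ∪ zdSepZoneB n ρ)) :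
    x ∈ box 2 (ρ + ρ / 8 + 1) := by
  rw [mem_box, Fin.forall_fin_two]
  obtain ⟨⟨h0, h1⟩, -⟩ := zone_sites hn hnρ hx
  have a0 := abs_le.1 h0; have a1 := abs_le.1 h1
  push_cast
  exact ⟨⟨by omega, by omega⟩, ⟨by omega, by omega⟩⟩

/-- **The zones of the big annulus avoid `B(ρ + ρ/8 + 1)`** when `ρ + ρ/8 + 1 ≤ ρ'/2`. [folklore] -/
theorem gl_zone_big_notMem (hρ' : 128 ≤ ρ') (hρ'R : 2 * ρ' ≤ R) (hsep : ρ + ρ / 8 + 1 ≤ ρ' / 2) {x : Site 2}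
    (hx : x ∈ zdSepZoneR ρ' R ∪ zdSepZoneL ρ' R ∪ (zdSepZoneT ρ' R ∪ zdSepZoneB ρ' R)) :
    x ∉ box 2 (ρ + ρ / 8 + 1) := by
  rw [mem_box, Fin.forall_fin_two]
  obtain ⟨-, h2, -⟩ := zone_sites hρ' hρ'R hx
  have hs : (ρ : ℤ) + (ρ / 8 : ℕ) + 1 ≤ (ρ' / 2 : ℕ) := by exact_mod_cast hsep
  push_cast
  rcases h2 with h2 | h2
  · rw [le_abs] at h2; omega
  · rw [le_abs] at h2; omega

end Geometry

/-! ### The gluing inequality -/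

section Probability

open scoped Classical

/-- Four-fold union bookkeeping for `DeterminedBy`. [folklore] -/
theorem determinedBy_inter4 {A₁ A₂ A₃ A₄ : Set (BondConfig (Site 2))} {F₁ F₂ F₃ F₄ : Finset (Sym2 (Site 2))}
    (h₁ : DeterminedBy A₁ ↑F₁) (h₂ : DeterminedBy A₂ ↑F₂) (h₃ : DeterminedBy A₃ ↑F₃) (h₄ : DeterminedBy A₄ ↑F₄) :
    DeterminedBy (A₁ ∩ A₂ ∩ (A₃ ∩ A₄)) ↑(F₁ ∪ F₂ ∪ (F₃ ∪ F₄)) := by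
  push_cast
  refine ((h₁.mono ?_).inter (h₂.mono ?_)).inter ((h₃.mono ?_).inter (h₄.mono ?_)) <;>
    intro e he <;> simp only [Set.mem_union] <;> tauto

/-- Harris for four increasing events with a common lower bound. [folklore] -/
theorem le_real_inter4_of_upper {A₁ A₂ A₃ A₄ : Set (BondConfig (Site 2))} {c : ℝ} (hc0 : 0 ≤ c)
    (u₁ : IsUpperSet A₁) (u₂ : IsUpperSet A₂) (u₃ : IsUpperSet A₃) (u₄ : IsUpperSet A₄)
    (m₁ : MeasurableSet A₁) (m₂ : MeasurableSet A₂) (m₃ : MeasurableSet A₃) (m₄ : MeasurableSet A₄)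
    (h₁ : c ≤ (bondPercolation (zdGraph 2) half).real A₁) (h₂ : c ≤ (bondPercolation (zdGraph 2) half).real A₂)
    (h₃ : c ≤ (bondPercolation (zdGraph 2) half).real A₃) (h₄ : c ≤ (bondPercolation (zdGraph 2) half).real A₄) :
    c ^ 4 ≤ (bondPercolation (zdGraph 2) half).real (A₁ ∩ A₂ ∩ (A₃ ∩ A₄)) := by
  have e : c ^ 4 = c * c * (c * c) := by ring
  rw [e]
  exact le_real_inter_of_upper (by positivity) (by positivity) (u₁.inter u₂) (u₃.inter u₄) (m₁.inter m₂) (m₃.inter m₄)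
    (le_real_inter_of_upper hc0 hc0 u₁ u₂ m₁ m₂ h₁ h₂) (le_real_inter_of_upper hc0 hc0 u₃ u₄ m₃ m₄ h₃ h₄)

/-- Harris for four decreasing events with a common lower bound. [folklore] -/
theorem le_real_inter4_of_lower {A₁ A₂ A₃ A₄ : Set (BondConfig (Site 2))} {c : ℝ} (hc0 : 0 ≤ c)
    (u₁ : IsLowerSet A₁) (u₂ : IsLowerSet A₂) (u₃ : IsLowerSet A₃) (u₄ : IsLowerSet A₄)
    (m₁ : MeasurableSet A₁) (m₂ : MeasurableSet A₂) (m₃ : MeasurableSet A₃) (m₄ : MeasurableSet A₄)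
    (h₁ : c ≤ (bondPercolation (zdGraph 2) half).real A₁) (h₂ : c ≤ (bondPercolation (zdGraph 2) half).real A₂)
    (h₃ : c ≤ (bondPercolation (zdGraph 2) half).real A₃) (h₄ : c ≤ (bondPercolation (zdGraph 2) half).real A₄) :
    c ^ 4 ≤ (bondPercolation (zdGraph 2) half).real (A₁ ∩ A₂ ∩ (A₃ ∩ A₄)) := by
  have e : c ^ 4 = c * c * (c * c) := by ring
  rw [e]
  exact le_real_inter_of_lower (by positivity) (by positivity) (u₁.inter u₂) (u₃.inter u₄) (m₁.inter m₂) (m₃.inter m₄)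
    (le_real_inter_of_lower hc0 hc0 u₁ u₂ m₁ m₂ h₁ h₂) (le_real_inter_of_lower hc0 hc0 u₃ u₄ m₃ m₄ h₃ h₄)

/-- A zone pair lies in the pairs of a finite set of sites containing the zone. [folklore] -/
theorem sym2_subset_coe_sym2 {Z : Set (Site 2)} {B : Finset (Site 2)} (h : ∀ x ∈ Z, x ∈ B) :
    Z.sym2 ⊆ (↑(B.sym2) : Set (Sym2 (Site 2))) := fun _ he =>
  Finset.mem_coe.2 (Finset.mem_sym2_iff.2 fun x hx => h x (Set.mem_sym2_iff_subset.1 he hx))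

set_option maxHeartbeats 4000000 in
/-- **The gluing inequality** (Kesten 1987, Lemma 6 with (2.43); Nolin 2008, Prop. 12 (ii) with
Lemma 13: "the free spaces `r_i` will allow us to use locally an FKG-type inequality"). For the
scales of `mem_fourArmTwoClusters_of_mem_glued` with `128 ≤ n`, `2n ≤ ρ`, `2ρ ≤ ρ'`,
`ρ + ρ/8 + 1 ≤ ρ'/2`, `2ρ' ≤ R`, and corridors of aspect ratio at most `k`, if
`c ≤ P_{1/2}(LR([0, kl-1] × [0, l-1]))` for all `l ≥ 1` (RSW, `rsw_lowerBound_holds k`), then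
`c⁸ · P(zdFourArmSep n ρ) · P(zdFourArmSep ρ' R) ≤ P(glued event)`: the two well-separated
events are independent (disjoint zones), the generalised FKG inequality
`bondPercolation_locallyMonotone_fkg` glues the four open corridors (increasing, read on the
corridor rectangles, probability `≥ c⁴` by RSW and Harris) and the four dual corridors (decreasing,
`≥ c⁴`) to them. [cite: Nolin2008, §4.3 Prop. 12 (ii) and Lemma 13 (arXiv 0711.4948: Prop. 11, Lemma 12)] [cite: KestenScalingCMP1987, §2 Lemma 6, (2.43)] -/
theorem real_glued_ge {r n ρ ρ' R M₀ K₀ M₁ K₁ h₀ h₁ k : ℕ} {c : ℝ}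
    (hM₀ : r + M₀ + 1 = n) (hK₀ : r + K₀ + 2 = n) (hM₁ : ρ + M₁ + 2 = ρ') (hK₁ : ρ + K₁ + 4 = ρ')
    (hh₀r : h₀ + 1 ≤ r) (hh₁r : h₁ + 2 ≤ r)
    (hn : 128 ≤ n) (hrn : r + n / 8 + 1 ≤ n) (hnρ : 2 * n ≤ ρ) (hρρ' : 2 * ρ ≤ ρ')
    (hsep : ρ + ρ / 8 + 1 ≤ ρ' / 2) (hρ'R : 2 * ρ' ≤ R)
    (hc0 : 0 < c) (hc : ∀ l : ℕ, 1 ≤ l → c ≤ crossingProb half (k * l - 1) (l - 1))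
    (hkM₀ : M₀ ≤ k * (h₀ + 1) - 1) (hkK₀ : K₀ + 1 ≤ k * (h₁ + 1) - 1)
    (hkM₁ : M₁ ≤ k * (ρ / 64 + 1) - 1) (hkK₁ : K₁ + 1 ≤ k * (ρ / 64 + 1) - 1) :
    c ^ 8 * ((bondPercolation (zdGraph 2) half).real (zdFourArmSep n ρ) *
        (bondPercolation (zdGraph 2) half).real (zdFourArmSep ρ' R)) ≤
      (bondPercolation (zdGraph 2) half).real
        (zdFourArmSep n ρ ∩ zdFourArmSep ρ' R ∩
          ((lrCrossingAt ![(r : ℤ), 0] M₀ h₀ ∩ lrCrossingAt ![-((r : ℤ) + M₀), 0] M₀ h₀ ∩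
              (lrCrossingAt ![(ρ : ℤ) + 1, 0] M₁ (ρ / 64) ∩ lrCrossingAt ![-((ρ : ℤ) + M₁ + 1), 0] M₁ (ρ / 64))) ∩
            (dualFaceCrossing ![0, (r : ℤ)] (h₁ + 1) K₀ ∩ dualFaceCrossing ![0, -((r : ℤ) + K₀)] (h₁ + 1) K₀ ∩
              (dualFaceCrossing ![0, (ρ : ℤ) + 2] (ρ / 64 + 1) K₁ ∩
                dualFaceCrossing ![0, -((ρ : ℤ) + K₁ + 2)] (ρ / 64 + 1) K₁)))) := by
  set μ := bondPercolation (zdGraph 2) half with hμ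
  -- the pair sets
  set P : Finset (Sym2 (Site 2)) :=
    ((rectangle M₀ h₀).image (· + (![(r : ℤ), 0] : Site 2))).sym2 ∪
      ((rectangle M₀ h₀).image (· + (![-((r : ℤ) + M₀), 0] : Site 2))).sym2 ∪
      (((rectangle M₁ (ρ / 64)).image (· + (![(ρ : ℤ) + 1, 0] : Site 2))).sym2 ∪
        ((rectangle M₁ (ρ / 64)).image (· + (![-((ρ : ℤ) + M₁ + 1), 0] : Site 2))).sym2) with hP
  set M : Finset (Sym2 (Site 2)) :=
    dualFaceCrossingPairs ![0, (r : ℤ)] (h₁ + 1) K₀ ∪ dualFaceCrossingPairs ![0, -((r : ℤ) + K₀)] (h₁ + 1) K₀ ∪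
      (dualFaceCrossingPairs ![0, (ρ : ℤ) + 2] (ρ / 64 + 1) K₁ ∪
        dualFaceCrossingPairs ![0, -((ρ : ℤ) + K₁ + 2)] (ρ / 64 + 1) K₁) with hM
  set Z : Set (Site 2) := zdSepZoneR n ρ ∪ zdSepZoneL n ρ ∪ (zdSepZoneT n ρ ∪ zdSepZoneB n ρ) ∪
    (zdSepZoneR ρ' R ∪ zdSepZoneL ρ' R ∪ (zdSepZoneT ρ' R ∪ zdSepZoneB ρ' R)) with hZ
  set ZS : Finset (Site 2) := (box 2 (R + R / 8 + 1)).filter (· ∈ Z) with hZS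
  set S : Finset (Sym2 (Site 2)) := ZS.sym2 \ (P ∪ M) with hS
  -- coordinates of the sites of the corridor pairs
  have hPsite : ∀ e ∈ P, ∀ x ∈ e, 0 ≤ x 1 ∧ (x 1 ≤ h₀ ∧ ((r : ℤ) ≤ x 0 ∧ x 0 ≤ n - 1 ∨ -(n : ℤ) + 1 ≤ x 0 ∧ x 0 ≤ -(r : ℤ)) ∨
      x 1 ≤ (ρ / 64 : ℕ) ∧ ((ρ : ℤ) + 1 ≤ x 0 ∧ x 0 ≤ ρ' - 1 ∨ -(ρ' : ℤ) + 1 ≤ x 0 ∧ x 0 ≤ -(ρ : ℤ) - 1)) := by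
    intro e he x hx
    simp only [hP, Finset.mem_union] at he
    rcases he with (he | he) | (he | he) <;> have h := apply_le_of_mem_rectanglePairs he hx <;>
      simp only [Matrix.cons_val_zero, Matrix.cons_val_one] at h <;> omega
  have hMsite : ∀ e ∈ M, ∀ x ∈ e, 0 ≤ x 0 ∧ (x 0 ≤ h₁ + 1 ∧ ((r : ℤ) - 1 ≤ x 1 ∧ x 1 ≤ n - 1 ∨ -(n : ℤ) + 1 ≤ x 1 ∧ x 1 ≤ -(r : ℤ) + 1) ∨
      x 0 ≤ (ρ / 64 : ℕ) + 1 ∧ ((ρ : ℤ) + 1 ≤ x 1 ∧ x 1 ≤ ρ' - 1 ∨ -(ρ' : ℤ) + 1 ≤ x 1 ∧ x 1 ≤ -(ρ : ℤ) - 1)) := by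
    intro e he x hx
    simp only [hM, Finset.mem_union] at he
    rcases he with (he | he) | (he | he) <;> have h := apply_le_of_mem_dualFaceCrossingPairs he hx <;>
      simp only [Matrix.cons_val_zero, Matrix.cons_val_one] at h <;> omega
  -- disjointness of `S`, `P`, `M`
  have hSP : Disjoint S P := disjoint_sdiff_self_left.mono_right le_sup_left
  have hSM : Disjoint S M := disjoint_sdiff_self_left.mono_right le_sup_right
  have hPM : Disjoint P M := by
    rw [Finset.disjoint_left]
    intro e heP heM
    obtain ⟨x, hx⟩ : ∃ x, x ∈ e := ⟨e.out.1, Sym2.out_fst_mem e⟩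
    have h1 := hPsite e heP x hx
    have h2 := hMsite e heM x hx
    omega
  -- zone pairs are common pairs or corridor pairs of their own class
  have hZS_mem : ∀ x ∈ Z, x ∈ ZS := fun x hx => by
    rw [hZS, Finset.mem_filter]
    exact ⟨gl_zone_box hn hnρ (by omega) (by omega) hρ'R hx, hx⟩
  have hRL : (zdSepZoneR n ρ).sym2 ∪ (zdSepZoneL n ρ).sym2 ∪ ((zdSepZoneR ρ' R).sym2 ∪ (zdSepZoneL ρ' R).sym2) ⊆
      (↑S ∪ ↑P : Set (Sym2 (Site 2))) := by
    intro e he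
    have hz : ∀ x ∈ e, x ∈ zdSepZoneR n ρ ∪ zdSepZoneL n ρ ∪ (zdSepZoneR ρ' R ∪ zdSepZoneL ρ' R) := fun x hx => by
      rcases he with (he | he) | (he | he)
      · exact Or.inl (Or.inl (Set.mem_sym2_iff_subset.1 he hx))
      · exact Or.inl (Or.inr (Set.mem_sym2_iff_subset.1 he hx))
      · exact Or.inr (Or.inl (Set.mem_sym2_iff_subset.1 he hx))
      · exact Or.inr (Or.inr (Set.mem_sym2_iff_subset.1 he hx))
    have hzZ : ∀ x ∈ e, x ∈ Z := fun x hx => by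
      rcases hz x hx with (h | h) | (h | h)
      · exact Or.inl (Or.inl (Or.inl h))
      · exact Or.inl (Or.inl (Or.inr h))
      · exact Or.inr (Or.inl (Or.inl h))
      · exact Or.inr (Or.inl (Or.inr h))
    by_cases heP : e ∈ P
    · exact Or.inr heP
    · left
      rw [Finset.mem_coe, hS, Finset.mem_sdiff, Finset.mem_union, Finset.mem_sym2_iff]
      refine ⟨fun x hx => hZS_mem x (hzZ x hx), ?_⟩
      rintro (h | h)
      · exact heP h
      · obtain ⟨x, hx⟩ : ∃ x, x ∈ e := ⟨e.out.1, Sym2.out_fst_mem e⟩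
        exact gl_notMem_zoneRL hn hrn hh₁r hnρ hρρ' hρ'R (hMsite e h x hx) (hz x hx)
  have hTB : (zdSepZoneT n ρ).sym2 ∪ (zdSepZoneB n ρ).sym2 ∪ ((zdSepZoneT ρ' R).sym2 ∪ (zdSepZoneB ρ' R).sym2) ⊆
      (↑S ∪ ↑M : Set (Sym2 (Site 2))) := by
    intro e he
    have hz : ∀ x ∈ e, x ∈ zdSepZoneT n ρ ∪ zdSepZoneB n ρ ∪ (zdSepZoneT ρ' R ∪ zdSepZoneB ρ' R) := fun x hx => by
      rcases he with (he | he) | (he | he)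
      · exact Or.inl (Or.inl (Set.mem_sym2_iff_subset.1 he hx))
      · exact Or.inl (Or.inr (Set.mem_sym2_iff_subset.1 he hx))
      · exact Or.inr (Or.inl (Set.mem_sym2_iff_subset.1 he hx))
      · exact Or.inr (Or.inr (Set.mem_sym2_iff_subset.1 he hx))
    have hzZ : ∀ x ∈ e, x ∈ Z := fun x hx => by
      rcases hz x hx with (h | h) | (h | h)
      · exact Or.inl (Or.inr (Or.inl h))
      · exact Or.inl (Or.inr (Or.inr h))
      · exact Or.inr (Or.inr (Or.inl h))
      · exact Or.inr (Or.inr (Or.inr h))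
    by_cases heM : e ∈ M
    · exact Or.inr heM
    · left
      rw [Finset.mem_coe, hS, Finset.mem_sdiff, Finset.mem_union, Finset.mem_sym2_iff]
      refine ⟨fun x hx => hZS_mem x (hzZ x hx), ?_⟩
      rintro (h | h)
      · obtain ⟨x, hx⟩ : ∃ x, x ∈ e := ⟨e.out.1, Sym2.out_fst_mem e⟩
        exact gl_notMem_zoneTB hn hrn hh₀r hnρ hρρ' hρ'R (hPsite e h x hx) (hz x hx)
      · exact heM h
  -- locality of the four classes
  have dAp : DeterminedBy ((zdSepOpenArmR n ρ ∩ zdSepOpenArmL n ρ) ∩ (zdSepOpenArmR ρ' R ∩ zdSepOpenArmL ρ' R))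
      (↑S ∪ ↑P) :=
    ((determinedBy_zdSepOpenArmR fun e he => hRL (Or.inl (Or.inl he))).inter
      (determinedBy_zdSepOpenArmL fun e he => hRL (Or.inl (Or.inr he)))).inter
      ((determinedBy_zdSepOpenArmR fun e he => hRL (Or.inr (Or.inl he))).inter
        (determinedBy_zdSepOpenArmL fun e he => hRL (Or.inr (Or.inr he))))
  have dAm : DeterminedBy ((zdSepDualArmT n ρ ∩ zdSepDualArmB n ρ) ∩ (zdSepDualArmT ρ' R ∩ zdSepDualArmB ρ' R))
      (↑S ∪ ↑M) :=
    ((determinedBy_zdSepDualArmT fun e he => hTB (Or.inl (Or.inl he))).inter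
      (determinedBy_zdSepDualArmB fun e he => hTB (Or.inl (Or.inr he)))).inter
      ((determinedBy_zdSepDualArmT fun e he => hTB (Or.inr (Or.inl he))).inter
        (determinedBy_zdSepDualArmB fun e he => hTB (Or.inr (Or.inr he))))
  have dBp : DeterminedBy (lrCrossingAt ![(r : ℤ), 0] M₀ h₀ ∩ lrCrossingAt ![-((r : ℤ) + M₀), 0] M₀ h₀ ∩
      (lrCrossingAt ![(ρ : ℤ) + 1, 0] M₁ (ρ / 64) ∩ lrCrossingAt ![-((ρ : ℤ) + M₁ + 1), 0] M₁ (ρ / 64))) ↑P := by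
    rw [hP]
    exact determinedBy_inter4 (determinedBy_openCrossing_image _ _ _ _) (determinedBy_openCrossing_image _ _ _ _)
      (determinedBy_openCrossing_image _ _ _ _) (determinedBy_openCrossing_image _ _ _ _)
  have dBm : DeterminedBy (dualFaceCrossing ![0, (r : ℤ)] (h₁ + 1) K₀ ∩ dualFaceCrossing ![0, -((r : ℤ) + K₀)] (h₁ + 1) K₀ ∩
      (dualFaceCrossing ![0, (ρ : ℤ) + 2] (ρ / 64 + 1) K₁ ∩ dualFaceCrossing ![0, -((ρ : ℤ) + K₁ + 2)] (ρ / 64 + 1) K₁)) ↑M := by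
    rw [hM]
    exact determinedBy_inter4 (determinedBy_dualFaceCrossing _ _ _) (determinedBy_dualFaceCrossing _ _ _)
      (determinedBy_dualFaceCrossing _ _ _) (determinedBy_dualFaceCrossing _ _ _)
  have hFKG := bondPercolation_locallyMonotone_fkg (zdGraph 2) half hSP hSM hPM
    (((isUpperSet_zdSepOpenArmR _ _).inter (isUpperSet_zdSepOpenArmL _ _)).inter
      ((isUpperSet_zdSepOpenArmR _ _).inter (isUpperSet_zdSepOpenArmL _ _)))
    (((isLowerSet_zdSepDualArmT _ _).inter (isLowerSet_zdSepDualArmB _ _)).inter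
      ((isLowerSet_zdSepDualArmT _ _).inter (isLowerSet_zdSepDualArmB _ _)))
    (((isUpperSet_lrCrossingAt _ _ _).inter (isUpperSet_lrCrossingAt _ _ _)).inter
      ((isUpperSet_lrCrossingAt _ _ _).inter (isUpperSet_lrCrossingAt _ _ _)))
    (((isLowerSet_dualFaceCrossing _ _ _).inter (isLowerSet_dualFaceCrossing _ _ _)).inter
      ((isLowerSet_dualFaceCrossing _ _ _).inter (isLowerSet_dualFaceCrossing _ _ _)))
    dAp dAm dBp dBm
  -- independence of the two well-separated events
  have dsep₁ : DeterminedBy (zdFourArmSep n ρ) ↑((box 2 (ρ + ρ / 8 + 1)).sym2) := by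
    have hb : ∀ x ∈ zdSepZoneR n ρ ∪ zdSepZoneL n ρ ∪ (zdSepZoneT n ρ ∪ zdSepZoneB n ρ), x ∈ box 2 (ρ + ρ / 8 + 1) :=
      fun x hx => gl_zone_small_box hn hnρ hx
    exact ((determinedBy_zdSepOpenArmR (sym2_subset_coe_sym2 fun x hx => hb x (Or.inl (Or.inl hx)))).inter
      (determinedBy_zdSepOpenArmL (sym2_subset_coe_sym2 fun x hx => hb x (Or.inl (Or.inr hx))))).inter
      ((determinedBy_zdSepDualArmT (sym2_subset_coe_sym2 fun x hx => hb x (Or.inr (Or.inl hx)))).inter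
        (determinedBy_zdSepDualArmB (sym2_subset_coe_sym2 fun x hx => hb x (Or.inr (Or.inr hx)))))
  have dsep₂ : DeterminedBy (zdFourArmSep ρ' R)
      ↑(((box 2 (R + R / 8 + 1)).filter fun x => x ∉ box 2 (ρ + ρ / 8 + 1)).sym2) := by
    have hb : ∀ x ∈ zdSepZoneR ρ' R ∪ zdSepZoneL ρ' R ∪ (zdSepZoneT ρ' R ∪ zdSepZoneB ρ' R),
        x ∈ (box 2 (R + R / 8 + 1)).filter fun x => x ∉ box 2 (ρ + ρ / 8 + 1) := fun x hx =>
      Finset.mem_filter.2 ⟨gl_zone_box hn hnρ (by omega) (by omega) hρ'R (Or.inr hx),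
        gl_zone_big_notMem (by omega) hρ'R hsep hx⟩
    exact ((determinedBy_zdSepOpenArmR (sym2_subset_coe_sym2 fun x hx => hb x (Or.inl (Or.inl hx)))).inter
      (determinedBy_zdSepOpenArmL (sym2_subset_coe_sym2 fun x hx => hb x (Or.inl (Or.inr hx))))).inter
      ((determinedBy_zdSepDualArmT (sym2_subset_coe_sym2 fun x hx => hb x (Or.inr (Or.inl hx)))).inter
        (determinedBy_zdSepDualArmB (sym2_subset_coe_sym2 fun x hx => hb x (Or.inr (Or.inr hx)))))
  have hdisj : Disjoint (↑((box 2 (ρ + ρ / 8 + 1)).sym2) : Set (Sym2 (Site 2)))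
      ↑(((box 2 (R + R / 8 + 1)).filter fun x => x ∉ box 2 (ρ + ρ / 8 + 1)).sym2) := by
    rw [Set.disjoint_left]
    intro e h1 h2
    rw [Finset.mem_coe, Finset.mem_sym2_iff] at h1 h2
    obtain ⟨x, hx⟩ : ∃ x, x ∈ e := ⟨e.out.1, Sym2.out_fst_mem e⟩
    exact (Finset.mem_filter.1 (h2 x hx)).2 (h1 x hx)
  have hind := bondPercolation_real_inter_of_disjoint (zdGraph 2) half hdisj dsep₁ dsep₂
    dsep₁.measurableSet_of_finset dsep₂.measurableSet_of_finset
  -- RSW and Harris in the two corridor classes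
  have hc0' := hc0.le
  have hBp : c ^ 4 ≤ μ.real (lrCrossingAt ![(r : ℤ), 0] M₀ h₀ ∩ lrCrossingAt ![-((r : ℤ) + M₀), 0] M₀ h₀ ∩
      (lrCrossingAt ![(ρ : ℤ) + 1, 0] M₁ (ρ / 64) ∩ lrCrossingAt ![-((ρ : ℤ) + M₁ + 1), 0] M₁ (ρ / 64))) :=
    le_real_inter4_of_upper hc0' (isUpperSet_lrCrossingAt _ _ _) (isUpperSet_lrCrossingAt _ _ _)
      (isUpperSet_lrCrossingAt _ _ _) (isUpperSet_lrCrossingAt _ _ _) (measurableSet_lrCrossingAt _ _ _)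
      (measurableSet_lrCrossingAt _ _ _) (measurableSet_lrCrossingAt _ _ _) (measurableSet_lrCrossingAt _ _ _)
      (le_real_lrCrossingAt_of_rsw_ratio hc _ hkM₀) (le_real_lrCrossingAt_of_rsw_ratio hc _ hkM₀)
      (le_real_lrCrossingAt_of_rsw_ratio hc _ hkM₁) (le_real_lrCrossingAt_of_rsw_ratio hc _ hkM₁)
  have hBm : c ^ 4 ≤ μ.real (dualFaceCrossing ![0, (r : ℤ)] (h₁ + 1) K₀ ∩ dualFaceCrossing ![0, -((r : ℤ) + K₀)] (h₁ + 1) K₀ ∩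
      (dualFaceCrossing ![0, (ρ : ℤ) + 2] (ρ / 64 + 1) K₁ ∩ dualFaceCrossing ![0, -((ρ : ℤ) + K₁ + 2)] (ρ / 64 + 1) K₁)) :=
    le_real_inter4_of_lower hc0' (isLowerSet_dualFaceCrossing _ _ _) (isLowerSet_dualFaceCrossing _ _ _)
      (isLowerSet_dualFaceCrossing _ _ _) (isLowerSet_dualFaceCrossing _ _ _) (measurableSet_dualFaceCrossing _ _ _)
      (measurableSet_dualFaceCrossing _ _ _) (measurableSet_dualFaceCrossing _ _ _) (measurableSet_dualFaceCrossing _ _ _)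
      (le_real_dualFaceCrossing_of_rsw_ratio hc _ hkK₀) (le_real_dualFaceCrossing_of_rsw_ratio hc _ hkK₀)
      (le_real_dualFaceCrossing_of_rsw_ratio hc _ hkK₁) (le_real_dualFaceCrossing_of_rsw_ratio hc _ hkK₁)
  -- regrouping of the arms
  have hset : (zdSepOpenArmR n ρ ∩ zdSepOpenArmL n ρ) ∩ (zdSepOpenArmR ρ' R ∩ zdSepOpenArmL ρ' R) ∩
      ((zdSepDualArmT n ρ ∩ zdSepDualArmB n ρ) ∩ (zdSepDualArmT ρ' R ∩ zdSepDualArmB ρ' R)) =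
        zdFourArmSep n ρ ∩ zdFourArmSep ρ' R := by
    ext ω
    simp only [zdFourArmSep, Set.mem_inter_iff]
    tauto
  rw [hset] at hFKG
  calc c ^ 8 * (μ.real (zdFourArmSep n ρ) * μ.real (zdFourArmSep ρ' R))
      = μ.real (zdFourArmSep n ρ ∩ zdFourArmSep ρ' R) * (c ^ 4 * c ^ 4) := by rw [hind]; ring
    _ ≤ μ.real (zdFourArmSep n ρ ∩ zdFourArmSep ρ' R) * (_ * _) :=
        mul_le_mul_of_nonneg_left (mul_le_mul hBp hBm (by positivity) measureReal_nonneg) measureReal_nonneg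
    _ ≤ _ := hFKG

/-- **Gluing two well-separated four-arm events** (Kesten 1987 (2.43); Nolin 2008 Prop. 12 (ii)):
under the scale hypotheses of `real_glued_ge` and `mem_fourArmTwoClusters_of_mem_glued`,
`c⁸ · P(zdFourArmSep n ρ) · P(zdFourArmSep ρ' R) ≤ P(fourArmTwoClusters r R)`.
[cite: Nolin2008, §4.3 Prop. 12 (ii) (arXiv 0711.4948: Prop. 11)] [cite: KestenScalingCMP1987, §2 Lemma 6, (2.43)] -/
theorem real_fourArmTwoClusters_ge_of_sep {r n ρ ρ' R M₀ K₀ M₁ K₁ h₀ h₁ k : ℕ} {c : ℝ}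
    (hr : 2 ≤ r) (hM₀ : r + M₀ + 1 = n) (hK₀ : r + K₀ + 2 = n) (hM₁ : ρ + M₁ + 2 = ρ') (hK₁ : ρ + K₁ + 4 = ρ')
    (hh₀r : h₀ + 1 ≤ r) (hh₀n : h₀ ≤ n / 64) (hh₁r : h₁ + 2 ≤ r) (hh₁n : h₁ ≤ n / 64)
    (hn : 128 ≤ n) (hrn : r + n / 8 + 1 ≤ n) (hnρ : 2 * n ≤ ρ) (hρρ' : 2 * ρ ≤ ρ')
    (hsep : ρ + ρ / 8 + 1 ≤ ρ' / 2) (hρ'R : 2 * ρ' ≤ R)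
    (hc0 : 0 < c) (hc : ∀ l : ℕ, 1 ≤ l → c ≤ crossingProb half (k * l - 1) (l - 1))
    (hkM₀ : M₀ ≤ k * (h₀ + 1) - 1) (hkK₀ : K₀ + 1 ≤ k * (h₁ + 1) - 1)
    (hkM₁ : M₁ ≤ k * (ρ / 64 + 1) - 1) (hkK₁ : K₁ + 1 ≤ k * (ρ / 64 + 1) - 1) :
    c ^ 8 * ((bondPercolation (zdGraph 2) half).real (zdFourArmSep n ρ) *
        (bondPercolation (zdGraph 2) half).real (zdFourArmSep ρ' R)) ≤
      (bondPercolation (zdGraph 2) half).real (fourArmTwoClusters r R) := by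
  refine (real_glued_ge hM₀ hK₀ hM₁ hK₁ hh₀r hh₁r hn hrn hnρ hρρ' hsep hρ'R hc0 hc hkM₀ hkK₀ hkM₁ hkK₁).trans ?_
  refine ENNReal.toReal_mono (measure_ne_top _ _) (measure_mono_ae ?_)
  have hae : ∀ᵐ ω ∂(bondPercolation (zdGraph 2) half), ω ⊆ (zdGraph 2).edgeSet :=
    ProbabilityTheory.setBernoulli_ae_subset
  filter_upwards [hae] with ω hω h
  obtain ⟨⟨hs₁, hs₂⟩, ⟨⟨hT₀R, hT₀L⟩, ⟨hT₁R, hT₁L⟩⟩, ⟨⟨hD₀T, hD₀B⟩, ⟨hD₁T, hD₁B⟩⟩⟩ := h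
  exact mem_fourArmTwoClusters_of_mem_glued hω hr hM₀ hK₀ hM₁ hK₁ hh₀r hh₀n hh₁r hh₁n (by omega) hrn (by omega)
    (by omega) (by omega) (by omega) (by omega) hs₁ hs₂ hT₀R hT₀L hT₁R hT₁L hD₀T hD₀B hD₁T hD₁B

end Probability

end Literature.Probability.Percolation

end
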